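import Literature.NumberTheory.GaloisRepresentations.AbstractReciprocityLaw
import Literature.NumberTheory.GaloisRepresentations.LocalWeilDatumNorm
import Literature.NumberTheory.GaloisRepresentations.LocalWeilDatumValuation
import Literature.NumberTheory.GaloisRepresentations.LocalReciprocityFinite
import HarnessLib

/-!
# The finite-level reciprocity system of a local field from Neukirch's abstract reciprocity law

Let `F` be a non-archimedean local field and `d : WeilDatum W_F (F^sep)ˣ` a Weil datum
(`AbstractClassFieldTheory.lean`) which **is the local one**: its fields are the Weil subgroups
`W_F ∩ G_K` of the finite separable `K ⊆ F̄`, its degree is `WeilGroup.deg` and its valuation is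
`ord_F` on `Fˣ` (`LocalWeilDatum.IsLocalDatum F d`; the construction of such a datum — Neukirch
Ch. V §1, "`G = G(k̄|k)`, `A = k̄*`, `v_K`" — is the object of `LocalWeilDatum*.lean`).  Assume
the **class field axiom** for `d` (`d.IsClassFieldTheory`, Neukirch IV (6.1); for local fields V (1.1)).

This file reads Neukirch's general reciprocity law (IV (6.3), files `AbstractReciprocityLaw*.lean`)
in Mathlib terms and produces the finite-level **reciprocity system** of `F`:

* `LocalWeilDatum.recSystem hd hcf L : Fˣ →* Gal(L/F)`, for finite abelian `L ⊆ F̄` the norm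
  residue symbol `x ↦ (x, L/F) = r_{L|F}⁻¹(x mod N_{L/F}Lˣ)` (through Neukirch's norm residue
  representative `normResidue` of the abelian pair `(W_F, W_F ∩ G_L)` and the restriction
  `W_F → G(L|F)`, `LocalWeilDatumNorm.weilRestrict`, surjective with kernel `W_F ∩ G_L`), characterised by
  `recSystem_eq_weilRestrict_iff : (x, L/F) = w|_L ↔ r_{L|F}(w) ≡ x`;
* `LocalWeilDatum.isReciprocitySystem`: it satisfies all clauses of
  `Literature.…IsReciprocitySystem F` (`LocalReciprocityFinite.lean`): surjective, kernel the norm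
  group `N_{L/F} Lˣ` (norm dictionary `unitOf_mem_normGroup_iff`), compatible in towers ((5.8)),
  units onto the inertia subgroup (`exists_inertia_recMap_eq_of_unit`,
  `exists_unit_recMap_eq_of_mem_inertia`), uniformiser to arithmetic Frobenius on unramified
  levels ((5.7));
* `LocalWeilDatum.exists_isReciprocitySystem`: hence the named fact
  `exists_isReciprocitySystem F` **follows from** the existence of a local Weil datum satisfying
  the class field axiom.

## References

* J. Neukirch, *Algebraic Number Theory*, Springer 1999, Ch. IV §6 (6.3)–(6.5), Ch. V §1
  ((1.1)–(1.3)). [NeukirchANT1999]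
* J.-P. Serre, *Local Fields*, GTM 67, Ch. XIII §4 (Prop. 12, Prop. 13 and Cor.). [SerreLocalFields1979]
-/

noncomputable section

open Field IsNonarchimedeanLocalField ValuativeRel
open scoped Pointwise

namespace Literature.NumberTheory.GaloisRepresentations

namespace LocalWeilDatum

open AbstractCFT AbstractCFT.WeilDatum

section Local

variable (F : Type*) [Field F] [ValuativeRel F] [TopologicalSpace F] [IsNonarchimedeanLocalField F]

/-! ### Local Weil data -/

/-- `IsLocalDatum F d`: the Weil datum `d` on `(W_F, (F^sep)ˣ)` **is the local one** — its fields
are the Weil subgroups of the finite separable subextensions of `F̄/F`, its degree is the degree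
of the Weil group (arithmetic Frobenius `↦ 1`), and its valuation is `ord_F` on `Fˣ ⊆ (F^sep)ˣ`
("`A_K = K*`", "`d_K`", "`v_K`" of Neukirch Ch. V §1).
[cite: NeukirchANT1999, Ch. V §1 (pp. 317–318)] -/
structure IsLocalDatum (d : WeilDatum (WeilGroup F) (SepUnits F)) : Prop where
  /-- The fields of `d` are the Weil subgroups `W_F ∩ G_K`, `K/F` finite separable. -/
  isField_iff : ∀ U : Subgroup (WeilGroup F), d.IsField U ↔ IsFieldSubgroup F U
  /-- The degree of `d` is `WeilGroup.deg`. -/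
  degZ_eq : ∀ w : WeilGroup F, d.degZ w = WeilGroup.deg w
  /-- The valuation of `d` is `ord_F` on `Fˣ`. -/
  v_unitOf : ∀ x : Fˣ, d.v (unitOf F x) = ord F x

variable {F}
variable {d : WeilDatum (WeilGroup F) (SepUnits F)}

namespace IsLocalDatum

omit [ValuativeRel F] [TopologicalSpace F] [IsNonarchimedeanLocalField F] in
/-- A Galois subextension is separable, hence inside `F^sep`. [folklore] -/
theorem le_sepClosure (L : IntermediateField F (AlgebraicClosure F)) [IsGalois F L] :
    L ≤ sepClosure F :=
  (le_separableClosure_iff F (AlgebraicClosure F) L).mpr inferInstance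

/-- Weil subgroups of finite separable subextensions are fields of a local datum. [folklore] -/
theorem isField_fieldSubgroup (hd : IsLocalDatum F d) (K : IntermediateField F (AlgebraicClosure F))
    [FiniteDimensional F K] (hKs : K ≤ sepClosure F) : d.IsField (fieldSubgroup F K) :=
  (hd.isField_iff _).mpr ⟨K, inferInstance, hKs, rfl⟩

/-- The inertia group of a local datum is the inertia group of the Weil group.
[cite: NeukirchANT1999, Ch. V §1] -/
theorem mem_inertia_iff (hd : IsLocalDatum F d) {w : WeilGroup F} :
    w ∈ d.inertia ↔ WeilGroup.toAbsGalois F w ∈ absInertia F := by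
  rw [WeilDatum.mem_inertia_iff, hd.degZ_eq, WeilGroup.deg_eq_zero_iff_mem_inertia IsFrobPow.mul_holds
    IsFrobPow.unique_holds, WeilGroup.mem_inertia_iff]

/-- `v_W(x) = ord_F(x)` on `Fˣ`. [cite: NeukirchANT1999, Ch. V §1] -/
theorem val_top_unitOf (hd : IsLocalDatum F d) (x : Fˣ) : d.val ⊤ (unitOf F x) = ord F x := by
  rw [d.val_top (unitOf_mem_fixedBy F x ⊤), hd.v_unitOf]

/-- The units of the ground field of a local datum are the units `𝒪_Fˣ`. [cite: NeukirchANT1999, Ch. V §1] -/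
theorem unitOf_mem_unitGroup_iff (hd : IsLocalDatum F d) (x : Fˣ) :
    unitOf F x ∈ d.unitGroup ⊤ ↔ x ∈ (valuation F).valuationSubring.unitGroup := by
  rw [d.mem_unitGroup_iff d.isField_top, hd.val_top_unitOf, Valuation.mem_unitGroup_iff,
    ord_eq_zero_iff F x.ne_zero]
  exact ⟨fun h => h.2, fun h => ⟨unitOf_mem_fixedBy F x ⊤, h⟩⟩

/-- For `L/F` finite abelian, `(W_F, W_F ∩ G_L)` is an abelian pair of the local datum.
[cite: NeukirchANT1999, Ch. IV §6, (6.3)] -/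
theorem isAbelianPair_top (hd : IsLocalDatum F d) (L : IntermediateField F (AlgebraicClosure F))
    [FiniteDimensional F L] [IsAbelianGalois F L] : d.IsAbelianPair ⊤ (fieldSubgroup F L) where
  isField_left := d.isField_top
  isField_right := hd.isField_fieldSubgroup L (le_sepClosure L)
  le := le_top
  commutator_mem := fun a _ b _ => by
    rw [← weilRestrict_eq_one_iff, map_mul, map_mul, map_mul, map_inv, map_inv,
      IsMulCommutative.is_comm.comm (weilRestrict F L a) (weilRestrict F L b), mul_inv_cancel_right,
      mul_inv_cancel]

end IsLocalDatum

/-! ### The reciprocity system -/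

/-- **The norm residue symbols of `F` from the abstract reciprocity law.**  For a local datum `d`
with the class field axiom and `L ⊆ F̄` finite abelian, `recSystem hd hcf L : Fˣ →* G(L|F)` is
`x ↦ (x, L/F) = τ|_L` for any `τ ∈ W_F` with `r_{L|F}(τ) ≡ x mod N_{L|F}` (Neukirch's norm residue
symbol `normResidue`, a representative well defined modulo `W_F ∩ G_L`, restricted to `L` by
`weilRestrict`); the trivial homomorphism on non-(finite abelian) `L`.
[cite: NeukirchANT1999, Ch. IV §6, after Thm. (6.3); Ch. V §1, Thm. (1.3)] -/
def recSystem (hd : IsLocalDatum F d) (hcf : d.IsClassFieldTheory)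
    (L : IntermediateField F (AlgebraicClosure F)) : Fˣ →* (L ≃ₐ[F] L) := by
  classical
  exact if h : FiniteDimensional F L ∧ IsAbelianGalois F L then
    haveI := h.1
    haveI := h.2
    { toFun := fun x => weilRestrict F L (hcf.normResidue (hd.isAbelianPair_top L) (unitOf_mem_fixedBy F x ⊤))
      map_one' := by
        rw [weilRestrict_eq_one_iff, hcf.normResidue_mem_iff,
          show unitOf F (1 : Fˣ) = 1 by simp [unitOf]]
        exact (normGroup _ _).one_mem
      map_mul' := fun x y => by
        have key : ∀ {a b : SepUnits F} (ha : a ∈ fixedBy (SepUnits F) (⊤ : Subgroup (WeilGroup F)))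
            (hb : b ∈ fixedBy (SepUnits F) (⊤ : Subgroup (WeilGroup F))), a = b →
            hcf.normResidue (hd.isAbelianPair_top L) ha = hcf.normResidue (hd.isAbelianPair_top L) hb := by
          rintro a b ha hb rfl
          rfl
        have hxy : unitOf F (x * y) = unitOf F x * unitOf F y := by simp [unitOf]
        rw [key (unitOf_mem_fixedBy F (x * y) ⊤) ((fixedBy (SepUnits F) ⊤).mul_mem (unitOf_mem_fixedBy F x ⊤)
          (unitOf_mem_fixedBy F y ⊤)) hxy, ← map_mul, eq_comm, ← inv_mul_eq_one, ← map_inv, ← map_mul,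
          weilRestrict_eq_one_iff, ← inv_mem_iff, mul_inv_rev, inv_inv]
        exact hcf.normResidue_mul_inv_mul_mem (hd.isAbelianPair_top L) (unitOf_mem_fixedBy F x ⊤)
          (unitOf_mem_fixedBy F y ⊤) }
  else 1

/-- Unfolding `recSystem` at a finite abelian level. [folklore] -/
theorem recSystem_apply (hd : IsLocalDatum F d) (hcf : d.IsClassFieldTheory)
    (L : IntermediateField F (AlgebraicClosure F)) [FiniteDimensional F L] [IsAbelianGalois F L]
    (x : Fˣ) : recSystem hd hcf L x =
      weilRestrict F L (hcf.normResidue (hd.isAbelianPair_top L) (unitOf_mem_fixedBy F x ⊤)) := by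
  rw [recSystem, dif_pos ⟨‹_›, ‹_›⟩]
  rfl

/-- **Defining property of the norm residue symbol**: `(x, L/F) = w|_L ↔ r_{L|F}(w) ≡ x mod N_{L|F}`.
[cite: NeukirchANT1999, Ch. IV §6, after Thm. (6.3)] -/
theorem recSystem_eq_weilRestrict_iff (hd : IsLocalDatum F d) (hcf : d.IsClassFieldTheory)
    (L : IntermediateField F (AlgebraicClosure F)) [FiniteDimensional F L] [IsAbelianGalois F L]
    (x : Fˣ) (w : WeilGroup F) :
    recSystem hd hcf L x = weilRestrict F L w ↔
      d.recMap ⊤ (fieldSubgroup F L) w = QuotientGroup.mk (unitOf F x) := by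
  rw [recSystem_apply, ← hcf.normResidue_inv_mul_mem_iff (hd.isAbelianPair_top L) (unitOf_mem_fixedBy F x ⊤)
    (Subgroup.mem_top w), ← weilRestrict_eq_one_iff, map_mul, map_inv, inv_mul_eq_one]

/-- **The reciprocity system of a local field from the abstract reciprocity law.**  For a local Weil
datum satisfying the class field axiom, the norm residue symbols `recSystem hd hcf` have all the
printed properties of Serre's `(x, L/F)` (`Literature.…IsReciprocitySystem F`): surjective with
kernel `N_{L/F} Lˣ` (Neukirch (6.3)), compatible in towers ((5.8) = Serre XIII §4 Prop. 12), units
onto the inertia subgroup and uniformisers to the arithmetic Frobenius on unramified levels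
((5.7), (6.2) = Serre XIII §4 Prop. 13 and Cor.).
[cite: NeukirchANT1999, Ch. IV §6, Thm. (6.3), (6.4), (6.5); Ch. V §1, Thm. (1.3)] -/
theorem isReciprocitySystem (hd : IsLocalDatum F d) (hcf : d.IsClassFieldTheory) :
    IsReciprocitySystem F (recSystem hd hcf) where
  surjective L _ _ := by
    intro g
    have hab := hd.isAbelianPair_top L
    obtain ⟨w, rfl⟩ := weilRestrict_surjective F L g
    obtain ⟨a, ha, h⟩ := d.recMap_mem_range d.isField_top hab.isField_right hab.le_normalizer
      (Subgroup.mem_top w)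
    obtain ⟨x, rfl⟩ := exists_unitOf_eq_of_mem_fixedBy_top F ha
    exact ⟨x, (recSystem_eq_weilRestrict_iff hd hcf L x w).mpr h⟩
  ker_eq L _ _ := by
    have hab := hd.isAbelianPair_top L
    ext x
    rw [MonoidHom.mem_ker, ← unitOf_mem_normGroup_iff F L (IsLocalDatum.le_sepClosure L) x,
      show (1 : L ≃ₐ[F] L) = weilRestrict F L 1 from (map_one _).symm,
      recSystem_eq_weilRestrict_iff,
      d.recMap_eq_one_of_mem d.isField_top hab.isField_right hab.le hab.le_normalizer
        (fieldSubgroup F L).one_mem, eq_comm, QuotientGroup.eq_one_iff]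
  compatible L L' _ _ _ _ hLL' x γ hγ := by
    have hab := hd.isAbelianPair_top L
    have hab' := hd.isAbelianPair_top L'
    haveI := d.finiteIndex hab.isField_right
    haveI := d.finiteIndex hab'.isField_right
    obtain ⟨w, hw⟩ := weilRestrict_surjective F L' (recSystem hd hcf L' x)
    rw [← hw] at hγ
    have h1 := (recSystem_eq_weilRestrict_iff hd hcf L' x w).mp hw.symm
    have h2 : d.recMap ⊤ (fieldSubgroup F L) w = QuotientGroup.mk (unitOf F x) := by
      rw [hcf.recMap_eq_map_recMap d.isField_top hab.isField_right hab.le hab.le_normalizer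
        hab'.isField_right hab'.le hab'.le_normalizer (fieldSubgroup_antitone F hLL')
        (Subgroup.mem_top w), h1]
      rfl
    rw [restrictNormalHom_eq_of_restrictNormalHom_eq F hLL' hγ]
    exact ((recSystem_eq_weilRestrict_iff hd hcf L x w).mpr h2).symm
  map_unitGroup L _ _ := by
    have hab := hd.isAbelianPair_top L
    apply le_antisymm
    · rintro _ ⟨u, hu, rfl⟩
      have hu' : unitOf F u ∈ d.unitGroup ⊤ := (hd.unitOf_mem_unitGroup_iff u).mpr hu
      obtain ⟨i, hi, hrec⟩ := hcf.exists_inertia_recMap_eq_of_unit hab hu'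
      refine ⟨WeilGroup.toAbsGalois F i, (hd.mem_inertia_iff).mp (Subgroup.mem_inf.mp hi).2, ?_⟩
      exact ((recSystem_eq_weilRestrict_iff hd hcf L u i).mpr hrec).symm
    · rintro _ ⟨σ, hσ, rfl⟩
      set i : WeilGroup F := WeilGroup.mk σ ⟨0, isFrobPow_zero_iff_mem_absInertia.mpr hσ⟩ with hi_def
      have hiI : i ∈ d.inertia := by
        rw [hd.mem_inertia_iff, hi_def, WeilGroup.toAbsGalois_mk]
        exact hσ
      obtain ⟨a, ha, hrec⟩ := hcf.exists_unit_recMap_eq_of_mem_inertia hab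
        (Subgroup.mem_inf.mpr ⟨Subgroup.mem_top i, hiI⟩)
      obtain ⟨u, rfl⟩ := exists_unitOf_eq_of_mem_fixedBy_top F (d.unitGroup_le_fixedBy d.isField_top ha)
      refine ⟨u, (hd.unitOf_mem_unitGroup_iff u).mp ha, ?_⟩
      rw [(recSystem_eq_weilRestrict_iff hd hcf L u i).mpr hrec, weilRestrict_apply, hi_def,
        WeilGroup.toAbsGalois_mk]
      rfl
  unramified_uniformizer L _ _ hL ϖ hϖ φ hφ := by
    have hab := hd.isAbelianPair_top L
    have hV := hab.isField_right
    -- `L ⊆ F^nr`: the pair `(W_F, W_F ∩ G_L)` is unramified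
    have hunr : d.IsUnramified (fieldSubgroup F L) ⊤ := by
      intro i hi
      have hiI := (hd.mem_inertia_iff).mp (Subgroup.mem_inf.mp hi).2
      exact (mem_fieldSubgroup_iff F).mpr fun x hx => hL _ hiI ⟨x, hx⟩
    -- the Frobenius `φ` as an element of `W_F` of degree `1 = f_W`
    have hφ1 : IsFrobPow φ 1 := IsAbsArithFrob.isFrobPow_holds hφ
    set w : WeilGroup F := WeilGroup.mk φ ⟨1, hφ1⟩ with hw_def
    have hdeg : d.degZ w = d.f ⊤ := by
      rw [d.f_top, hd.degZ_eq, Nat.cast_one]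
      exact (WeilGroup.deg_eq_iff IsFrobPow.mul_holds IsFrobPow.unique_holds).mpr
        (by rw [hw_def, WeilGroup.toAbsGalois_mk]; exact hφ1)
    have hπ : unitOf F ϖ ∈ fixedBy (SepUnits F) (⊤ : Subgroup (WeilGroup F)) := unitOf_mem_fixedBy F ϖ ⊤
    have hvπ : d.val ⊤ (unitOf F ϖ) = 1 := by
      rw [hd.val_top_unitOf]
      exact (ord_eq_one_iff F ϖ.ne_zero).mpr hϖ
    have hrec := hcf.recMap_frob_eq d.isField_top hV le_top hunr (Subgroup.mem_top w) hdeg hπ hvπ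
    rw [(recSystem_eq_weilRestrict_iff hd hcf L ϖ w).mpr hrec, weilRestrict_apply, hw_def,
      WeilGroup.toAbsGalois_mk]

/-- **The finite-level reciprocity fact of `F` from a local class field theory**: if a local Weil
datum satisfying Neukirch's class field axiom exists, then `exists_isReciprocitySystem F`
(the named fact of `LocalReciprocityFinite.lean`: Serre XIII §4 Thm. 1, Prop. 8 Cor., Props. 12–13).
[cite: NeukirchANT1999, Ch. V §1, Thm. (1.3)] -/
theorem exists_isReciprocitySystem (hd : IsLocalDatum F d) (hcf : d.IsClassFieldTheory) :
    exists_isReciprocitySystem F :=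
  ⟨recSystem hd hcf, isReciprocitySystem hd hcf⟩

end Local

end LocalWeilDatum

end Literature.NumberTheory.GaloisRepresentations
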